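import Mathlib

/-!
# Route `SquareRootCeilings`, child `AxisMirrorCeiling` (stmt-QuantumFields-26791): the Hankel engine

The lever of the rev-1 split of `SubOnsetTwoPointCeilings` reads the on-axis mirror-pair covariance
`c_{q,k}(t) = Cov_T(P_q(0), P_q(t e_k))` through reflection positivity as a matrix coefficient `⟪â, Tᵗ â⟫` of the
(symmetric, positive, contractive) transfer operator `T` in direction `k` at the centred one-plaquette vector `â`
(Osterwalder–Seiler; on the torus of side `2L+1` this is the slab transfer matrix, here its half-space shadow).
Such sequences are HANKEL-positive, and the one inequality the child's ceiling propagates along the axis is the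
log-convexity below: `c(s+t)² ≤ c(2s)·c(2t)`, with `c(2s) = ‖Tˢâ‖² ≥ 0`.  This file proves that engine for an arbitrary
symmetric linear operator on a real inner-product space (no measure, no gauge field): it is the functional-analytic
rung of `AxisMirrorCeiling`, in a regime where nothing about Yang–Mills is asserted.  No crux, leg, leaf or summit is
proved here.  [folklore; Fröhlich–Israel–Lieb–Simon 1978 §2, Glimm–Jaffe §6.1]
-/

set_option autoImplicit false

namespace Summit.QuantumFields.YangMills.Cruxes.AxisMirrorCeiling.Rung

open scoped InnerProductSpace

variable {E : Type*} [NormedAddCommGroup E] [InnerProductSpace ℝ E]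

/-- Powers of a symmetric operator are symmetric: `⟪Tⁿ x, y⟫ = ⟪x, Tⁿ y⟫`. -/
theorem inner_pow_apply_left {T : E →ₗ[ℝ] E} (hT : T.IsSymmetric) (n : ℕ) (x y : E) :
    ⟪(T ^ n) x, y⟫_ℝ = ⟪x, (T ^ n) y⟫_ℝ := by
  induction n generalizing x y with
  | zero => simp
  | succ n ih =>
    calc ⟪(T ^ (n + 1)) x, y⟫_ℝ = ⟪(T ^ n) (T x), y⟫_ℝ := by rw [pow_succ, Module.End.mul_apply]
      _ = ⟪T x, (T ^ n) y⟫_ℝ := ih _ _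
      _ = ⟪x, T ((T ^ n) y)⟫_ℝ := hT _ _
      _ = ⟪x, (T ^ (n + 1)) y⟫_ℝ := by rw [pow_succ', Module.End.mul_apply]

/-- Even matrix coefficients are squares of norms: `⟪a, T²ˢ a⟫ = ⟪Tˢa, Tˢa⟫`. -/
theorem inner_pow_two_mul {T : E →ₗ[ℝ] E} (hT : T.IsSymmetric) (a : E) (s : ℕ) :
    ⟪a, (T ^ (2 * s)) a⟫_ℝ = ⟪(T ^ s) a, (T ^ s) a⟫_ℝ := by
  rw [two_mul, pow_add, Module.End.mul_apply, ← inner_pow_apply_left hT s]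

/-- Even matrix coefficients of a symmetric operator are non-negative (Hankel positivity on the diagonal). -/
theorem inner_pow_two_mul_nonneg {T : E →ₗ[ℝ] E} (hT : T.IsSymmetric) (a : E) (s : ℕ) :
    0 ≤ ⟪a, (T ^ (2 * s)) a⟫_ℝ := by
  rw [inner_pow_two_mul hT a s]
  exact real_inner_self_nonneg

/-- **Hankel log-convexity (the engine of `AxisMirrorCeiling`).**  For a symmetric operator `T` and a vector `a`,
`⟪a, Tˢ⁺ᵗ a⟫² ≤ ⟪a, T²ˢ a⟫ · ⟪a, T²ᵗ a⟫` — Cauchy–Schwarz between `Tˢa` and `Tᵗa`. -/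
theorem hankelLogConvex {T : E →ₗ[ℝ] E} (hT : T.IsSymmetric) (a : E) (s t : ℕ) :
    ⟪a, (T ^ (s + t)) a⟫_ℝ ^ 2 ≤ ⟪a, (T ^ (2 * s)) a⟫_ℝ * ⟪a, (T ^ (2 * t)) a⟫_ℝ := by
  have h1 : ⟪a, (T ^ (s + t)) a⟫_ℝ = ⟪(T ^ s) a, (T ^ t) a⟫_ℝ := by
    rw [pow_add, Module.End.mul_apply, ← inner_pow_apply_left hT s]
  rw [h1, inner_pow_two_mul hT a s, inner_pow_two_mul hT a t, sq]
  exact real_inner_mul_inner_self_le _ _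

/-- The mirror-pair reading used by `MirrorDomination`/`AxisMirrorCeiling`: a ceiling `M` on the two EVEN (mirror)
coefficients `⟪a, T²ˢa⟫, ⟪a, T²ᵗa⟫` forces `|⟪a, Tˢ⁺ᵗa⟫| ≤ M` at the intermediate distance. -/
theorem abs_inner_pow_le_of_even_le {T : E →ₗ[ℝ] E} (hT : T.IsSymmetric) (a : E) (s t : ℕ) {M : ℝ}
    (hs : ⟪a, (T ^ (2 * s)) a⟫_ℝ ≤ M) (ht : ⟪a, (T ^ (2 * t)) a⟫_ℝ ≤ M) :
    |⟪a, (T ^ (s + t)) a⟫_ℝ| ≤ M := by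
  have h0s := inner_pow_two_mul_nonneg hT a s
  have h0t := inner_pow_two_mul_nonneg hT a t
  have hM : 0 ≤ M := le_trans h0s hs
  have key := hankelLogConvex hT a s t
  have hsq : ⟪a, (T ^ (s + t)) a⟫_ℝ ^ 2 ≤ M ^ 2 := by
    calc ⟪a, (T ^ (s + t)) a⟫_ℝ ^ 2 ≤ ⟪a, (T ^ (2 * s)) a⟫_ℝ * ⟪a, (T ^ (2 * t)) a⟫_ℝ := key
      _ ≤ M * M := mul_le_mul hs ht h0t hM
      _ = M ^ 2 := (sq M).symm
  exact abs_le_of_sq_le_sq' hsq hM |>.elim (fun h1 h2 => abs_le.mpr ⟨h1, h2⟩)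

end Summit.QuantumFields.YangMills.Cruxes.AxisMirrorCeiling.Rung
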